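import Literature.MathematicalPhysics.QuantumFieldTheory.Balaban1983to89.B11SectG

/-!
# `Balaban1983to89.B11SupSize190` — T. Bałaban, *The variational problem and background fields in renormalization group
# method for lattice gauge theories*, Commun. Math. Phys. **102** (1985) 277–309 [Balaban1985Variational] = "[15]" of the
# later papers, Sect. G (190) p. 308 *"for x ∈ Δ(y)"*: the ZEROTH-ORDER local size *"sup_{x∈Δ(y)} |f(x)|"* of (190) as a
# `B11SectG.BlockNorm` on VECTOR-VALUED functions over an ARBITRARY (possibly infinite) point set `X` — the function-size
# half of the block-size ↔ lattice-value DICTIONARY of the (190)-knitting programme (cell GAPS.md G-B15-r12-08 / G-B14-08),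
# so that its hypotheses `hdom : ‖f(x)‖ ≤ bout.loc y f` become the lemma `norm_apply_le_loc` (membership of `x` in the block)

statement-level skeleton of published theorems with citation tags; proofs where landed; nothing here is a claim
about the Yang–Mills mass gap

CITATION HEADER (lean-in-tree rule 2026-08-18).  T. Bałaban, *The variational problem and background fields in
renormalization group method for lattice gauge theories*, Commun. Math. Phys. **102**, 277–309 (1985),
doi:10.1007/bf01229381, bib `Balaban1985Variational` (cell paper B11; PDF held
`paper:balaban1985-cmp102-variational-background`, journal page = PDF page + 276; p. 308 [PDF 32] read on the x2 render
`b2b-balaban-ref1/pages/1985-cmp102-variational-background/…-p032-x2.png` by the authors of `B11SectG`/`B11StarDecay190`,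
quoted from there).  "[3]" = [Balaban1984PropagatorsII] (2.51)–(2.52) p. 232 (the sharp blocks Δ(y) and their partition of
unity, typed as `BlockNorm.cut`/`sum_cut` in `B11SectG`).

WHAT IS REPRODUCED.  The vocabulary item of [15] (190) p. 308, verbatim: *"|(δ/δB_ν(y′))𝓗_μ(B,x)|, … ≤ O(1)[(L^jη)^{−1}, …]
·(L^{j′}η)^{−d} exp(−⅛δ₀d(y,y′))  (190)  for x ∈ Δ(y), or supp ζ ⊂ Δ̃(y), y ∈ Λ_j, y′ ∈ Λ_{j′}"* — i.e. the output size of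
the FIRST entry of (190) is the supremum of `|·|` over the block `Δ(y)` — for the use made of it by the cell's
(190)-knitting files (`B15HDecayLeaves`, `B15Ineq1xxFrom190`, `B14Ineq38From190`, `B14Ineq319From190`, `B14Eq322From190`,
`B14Eq119From190`), whose lattice consumers (p29's `ℤ^d` carriers `B7Prop1Explicit.Site d → Fin d → 𝔸`) need a `BlockNorm`
on an INFINITE point set with values in a normed group.  SKELETON rows served: B11.Eq190 (vocabulary), and the dictionary
hypotheses of rows B14.Claim@265, B14.Eq3.16–3.19, B14.Eq3.21–3.22, B14.Eq1.18–1.19, B15.Eq1.31/1.37–1.39/1.42/1.46/1.48/1.91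
(cell GAPS.md G-B15-r12-08: *"a model instance … wants either finitely supported fields / a finite window … Estimated size:
one definition file (the sup-over-block sizes …, `cut` = restriction to the block, `IsLoc` = support in the block;
`loc_cut_le` with κ = 1) + the `le_sup` lemmas"* — THIS is that file, for the FUNCTION size; its addendum records why the
DERIVATIVE size `sup|∇^ξ_{U₀}f|` is NOT a naive sup-`BlockNorm` (restriction cuts create jumps) — not attempted here).
Mega-formalization `lit-balaban`, HOME `run/shared/lean/pub/lit-balaban/`, unit `lit-balaban-r11` gen 7 (B14 fold owner;
cross-block infrastructure filed from the B14 side, r12's B15 gen 8 being closed).  Siblings (finite `X`, real values,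
weights): `B11SectG.BlockNorm.ofBlocks`, `B11KernelDictionary.weightedBlocks` — same conventions (sharp cuts, κ = 1).

WHAT THIS FILE DEFINES AND PROVES (zero `sorry`; definitions with bodies + proved API; no new `Prop`-valued fact).
* `supNorm s f = max_{x∈s} ‖f x‖` (`0` for `s = ∅`) for a FINITE set `s : Finset X` of points of an arbitrary type `X` and
  `f : X → E`, `E` a normed additive group — via `Finset.sup` of the `ℝ≥0`-valued norms; API `supNorm_nonneg`,
  `norm_le_supNorm` (the `le_sup` lemma), `supNorm_le`, `supNorm_zero`, `supNorm_add_le`, `supNorm_neg`, `supNorm_ite_le`.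
* `pieceOf blk y` — the sharp restriction to the block `{x | blk x = y}` as an `ℝ`-linear map of `X → E` ([3] (2.51)–(2.52)),
  `sum_pieceOf` (`Σ_y Δ(y)·f = f` over the finite block set `g.Site`), `pieceOf_apply`.
* `supSize g box blk : BlockNorm g (X → E)` — **the sup size of (190)**: `loc y f = supNorm (box y) f` for ANY assignment
  `box : g.Site → Finset X` of a finite point set to each block (print: the points of `Δ(y)`; for the `ℤ^d` consumers: the
  bonds of `B^k(y)`, or of `B^k(b₋) ∪ B^k(b₊)`), `cut = pieceOf blk` for ANY block map `blk : X → g.Site` (every point of the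
  possibly infinite `X` belongs to exactly one of the finitely many blocks — e.g. one block collecting everything outside a
  finite window), `IsLoc y f` = *"f vanishes off the block of y"*, `κ = 1`; ALL `BlockNorm` axioms PROVED with no relation
  between `box` and `blk` needed (`loc_cut_le`: restricting never increases a sup of norms).
* THE DICTIONARY LEMMAS: `supSize_loc` (unfolding), `norm_apply_le_loc` (`x ∈ box y → ‖f x‖ ≤ (supSize g box blk).loc y f`),
  `norm_apply_apply_le_loc` (for `E = ι → E′` with the sup norm: `x ∈ box y → ‖f x i‖ ≤ loc y f` — exactly the shape
  `‖Hf y′ μ‖ ≤ bout.loc y Hf` of the consumers' `hdom`), `loc_le_of_forall` (a uniform pointwise bound on the box bounds the size).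
HONEST SCOPE.  A MODEL of one size of [15] ((190)'s first entry, weight absorbed into the constant `C` of
`B11SectG.Ineq190`), chosen to fit the cell's lattice consumers; print's Δ(y), Λ_j, the η-scale weights `(L^jη)^{−n}` and the
smooth localisations `Δ̃(y)`/`ζ` of the higher entries are NOT modelled (weights: `B11KernelDictionary.weightedBlocks` on
finite `X`); whether a given `Ineq190 bB (supSize g box blk) dH C δ₀` HOLDS is [15] Prop. 9 — a hypothesis of every consumer,
untouched.  Value = the function-size dictionary of G-B15-r12-08 / G-B14-08 turned from a hypothesis kind into a lemma;
NOT summit progress.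
-/

open scoped NNReal

namespace Literature.MathematicalPhysics.QuantumFieldTheory.Balaban1983to89.B11SupSize190

open Literature.MathematicalPhysics.QuantumFieldTheory.Balaban1983to89
open B11SectG

/-! ## §1 The sup of norms over a finite point set -/

section SupNorm

variable {X : Type*} {E : Type*} [SeminormedAddCommGroup E]

/-- `supNorm s f = max_{x∈s} ‖f x‖` (and `0` if `s = ∅`): the zeroth-order local size *"sup_{x∈Δ(y)}|f(x)|"* of (190) over a
finite point set. [cite: Balaban1985Variational, (190) p.308] -/
noncomputable def supNorm (s : Finset X) (f : X → E) : ℝ :=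
  ((s.sup fun x => ‖f x‖₊ : ℝ≥0) : ℝ)

/-- `0 ≤ supNorm s f`. [cite: Balaban1985Variational, (190) p.308] -/
theorem supNorm_nonneg (s : Finset X) (f : X → E) : 0 ≤ supNorm s f := NNReal.coe_nonneg _

/-- THE `le_sup` LEMMA: `x ∈ s → ‖f x‖ ≤ supNorm s f`. [cite: Balaban1985Variational, (190) p.308] -/
theorem norm_le_supNorm {s : Finset X} (f : X → E) {x : X} (hx : x ∈ s) : ‖f x‖ ≤ supNorm s f := by
  have h : ‖f x‖₊ ≤ s.sup fun x => ‖f x‖₊ := Finset.le_sup (f := fun x => ‖f x‖₊) hx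
  have h' : ((‖f x‖₊ : ℝ≥0) : ℝ) ≤ ((s.sup fun x => ‖f x‖₊ : ℝ≥0) : ℝ) := NNReal.coe_le_coe.mpr h
  simpa [supNorm, coe_nnnorm] using h'

/-- A uniform pointwise bound on `s` bounds the size: `(∀ x ∈ s, ‖f x‖ ≤ c) → 0 ≤ c → supNorm s f ≤ c`.
[cite: Balaban1985Variational, (190) p.308] -/
theorem supNorm_le {s : Finset X} {f : X → E} {c : ℝ} (hc : 0 ≤ c) (h : ∀ x ∈ s, ‖f x‖ ≤ c) : supNorm s f ≤ c := by
  have h1 : (s.sup fun x => ‖f x‖₊) ≤ c.toNNReal := Finset.sup_le fun x hx => by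
    rw [← NNReal.coe_le_coe, coe_nnnorm, Real.coe_toNNReal _ hc]
    exact h x hx
  have h2 : ((s.sup fun x => ‖f x‖₊ : ℝ≥0) : ℝ) ≤ ((c.toNNReal : ℝ≥0) : ℝ) := NNReal.coe_le_coe.mpr h1
  rw [Real.coe_toNNReal _ hc] at h2
  exact h2

/-- `supNorm s 0 = 0`. [cite: Balaban1985Variational, (190) p.308] -/
theorem supNorm_zero (s : Finset X) : supNorm s (0 : X → E) = 0 :=
  le_antisymm (supNorm_le le_rfl fun x _ => by simp) (supNorm_nonneg s 0)

/-- Subadditivity: `supNorm s (f + f′) ≤ supNorm s f + supNorm s f′`. [cite: Balaban1985Variational, (190) p.308] -/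
theorem supNorm_add_le (s : Finset X) (f f' : X → E) : supNorm s (f + f') ≤ supNorm s f + supNorm s f' :=
  supNorm_le (add_nonneg (supNorm_nonneg s f) (supNorm_nonneg s f')) fun x hx =>
    (norm_add_le (f x) (f' x)).trans (add_le_add (norm_le_supNorm f hx) (norm_le_supNorm f' hx))

/-- `supNorm s (−f) = supNorm s f`. [cite: Balaban1985Variational, (190) p.308] -/
theorem supNorm_neg (s : Finset X) (f : X → E) : supNorm s (-f) = supNorm s f := by
  simp [supNorm, nnnorm_neg]

/-- Restricting pointwise never increases the size: `supNorm s (x ↦ if p x then f x else 0) ≤ supNorm s f`.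
[cite: Balaban1985Variational, (190) p.308] -/
theorem supNorm_ite_le (s : Finset X) (f : X → E) (p : X → Prop) [DecidablePred p] :
    supNorm s (fun x => if p x then f x else 0) ≤ supNorm s f :=
  supNorm_le (supNorm_nonneg s f) fun x hx => by
    by_cases hp : p x
    · rw [if_pos hp]; exact norm_le_supNorm f hx
    · rw [if_neg hp, norm_zero]; exact supNorm_nonneg s f

/-- Monotonicity in the point set: `s ⊆ t → supNorm s f ≤ supNorm t f`. [cite: Balaban1985Variational, (190) p.308] -/
theorem supNorm_mono {s t : Finset X} (hst : s ⊆ t) (f : X → E) : supNorm s f ≤ supNorm t f :=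
  supNorm_le (supNorm_nonneg t f) fun _ hx => norm_le_supNorm f (hst hx)

end SupNorm

/-! ## §2 The sharp restriction to a block ([3] (2.51)–(2.52)) -/

section Piece

variable {X : Type*} {E : Type*} [AddCommGroup E] [Module ℝ E] {S : Type*}

open scoped Classical in
/-- `pieceOf blk y f = Δ(y)·f`: the restriction of `f` to the block `{x | blk x = y}` (zero elsewhere), `ℝ`-linear in `f` —
the sharp partition of unity *"Σ_y Δ(y) = I"* of [3] (2.52), one piece.
[cite: Balaban1984PropagatorsII, (2.51)–(2.52) p.232] -/
noncomputable def pieceOf (blk : X → S) (y : S) : (X → E) →ₗ[ℝ] (X → E) where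
  toFun f x := if blk x = y then f x else 0
  map_add' f f' := by
    funext x; by_cases hx : blk x = y <;> simp [hx]
  map_smul' c f := by
    funext x; by_cases hx : blk x = y <;> simp [hx]

open scoped Classical in
/-- Unfolding. [cite: Balaban1984PropagatorsII, (2.51)–(2.52) p.232] -/
theorem pieceOf_apply (blk : X → S) (y : S) (f : X → E) (x : X) :
    pieceOf blk y f x = if blk x = y then f x else 0 := rfl

/-- *"Σ_y Δ(y) = I"*: over a finite block set the pieces add up to `f` (every point lies in exactly one block).
[cite: Balaban1984PropagatorsII, (2.52) p.232] -/
theorem sum_pieceOf [Fintype S] (blk : X → S) (f : X → E) : ∑ y, pieceOf blk y f = f := by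
  classical
  funext x
  rw [Finset.sum_apply]
  simp [pieceOf_apply]

end Piece

/-! ## §3 The sup size of (190) as a `BlockNorm` over an arbitrary point set -/

section SupSize

variable {g : B6.Geometry} {X : Type} {E : Type} [NormedAddCommGroup E] [Module ℝ E]

/-- **THE SUP SIZE OF (190)** — *"… for x ∈ Δ(y)"*: the `B11SectG.BlockNorm` on `X → E` (`X` ANY point set, e.g. the bonds of
`ℤ^d`; `E` a normed additive group with an `ℝ`-module structure, e.g. `Fin d → 𝔸`) with `loc y f = max_{x ∈ box y} ‖f x‖` for
an assignment `box` of a FINITE point set to each of the finitely many blocks `y ∈ g.Site` (print: the points of Δ(y)),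
`cut y = Δ(y)·` the sharp restriction along a block map `blk : X → g.Site`, `IsLoc y f` = *"f vanishes off Δ(y)"*, `κ = 1`.
No compatibility of `box` with `blk` is needed for the axioms. [cite: Balaban1985Variational, (190) p.308] -/
noncomputable def supSize (g : B6.Geometry) (box : g.Site → Finset X) (blk : X → g.Site) : BlockNorm g (X → E) where
  loc y f := supNorm (box y) f
  cut y := pieceOf blk y
  IsLoc y f := ∀ x, blk x ≠ y → f x = 0
  κ := 1
  κ_nonneg := zero_le_one
  loc_nonneg y f := supNorm_nonneg (box y) f
  loc_zero y := supNorm_zero (box y)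
  loc_add_le y f f' := supNorm_add_le (box y) f f'
  loc_neg y f := supNorm_neg (box y) f
  sum_cut f := sum_pieceOf blk f
  isLoc_cut y f x hx := by
    classical
    rw [pieceOf_apply, if_neg hx]
  loc_cut_le y f := by
    classical
    rw [one_mul]
    show supNorm (box y) (fun x => pieceOf blk y f x) ≤ supNorm (box y) f
    simp only [pieceOf_apply]
    exact supNorm_ite_le (box y) f (fun x => blk x = y)

variable {box : g.Site → Finset X} {blk : X → g.Site}

/-- Unfolding: `(supSize g box blk).loc y f = supNorm (box y) f`. [cite: Balaban1985Variational, (190) p.308] -/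
@[simp] theorem supSize_loc (y : g.Site) (f : X → E) : (supSize g box blk : BlockNorm g (X → E)).loc y f = supNorm (box y) f :=
  rfl

/-- Unfolding: `(supSize g box blk).κ = 1`. [cite: Balaban1985Variational, (190) p.308] -/
@[simp] theorem supSize_κ : (supSize g box blk : BlockNorm g (X → E)).κ = 1 := rfl

/-- Unfolding: `IsLoc y f ↔ f` vanishes off the block of `y`. [cite: Balaban1985Variational, (190) p.308] -/
theorem supSize_isLoc_iff (y : g.Site) (f : X → E) :
    (supSize g box blk : BlockNorm g (X → E)).IsLoc y f ↔ ∀ x, blk x ≠ y → f x = 0 := Iff.rfl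

/-- **THE DICTIONARY LEMMA (values)**: a point of the box of `y` is dominated by the size at `y` —
`x ∈ box y → ‖f x‖ ≤ (supSize g box blk).loc y f`. [cite: Balaban1985Variational, (190) p.308] -/
theorem norm_apply_le_loc {y : g.Site} {x : X} (hx : x ∈ box y) (f : X → E) :
    ‖f x‖ ≤ (supSize g box blk : BlockNorm g (X → E)).loc y f :=
  norm_le_supNorm f hx

/-- A uniform pointwise bound on the box bounds the size: `(∀ x ∈ box y, ‖f x‖ ≤ c) → 0 ≤ c → loc y f ≤ c`.
[cite: Balaban1985Variational, (190) p.308] -/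
theorem loc_le_of_forall {y : g.Site} {f : X → E} {c : ℝ} (hc : 0 ≤ c) (h : ∀ x ∈ box y, ‖f x‖ ≤ c) :
    (supSize g box blk : BlockNorm g (X → E)).loc y f ≤ c :=
  supNorm_le hc h

end SupSize

section Components

variable {g : B6.Geometry} {X : Type} {ι : Type} [Fintype ι] {E' : Type} [NormedAddCommGroup E'] [Module ℝ E']
variable {box : g.Site → Finset X} {blk : X → g.Site}

/-- **THE DICTIONARY LEMMA (components)** — for functions with values in a finite product `ι → E′` (sup norm; the cell's
bond fields `x ↦ (μ ↦ H x μ)`): `x ∈ box y → ‖f x i‖ ≤ (supSize g box blk).loc y f` — exactly the shape `‖Hf y′ μ‖ ≤ bout.loc y Hf`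
of the consumers' hypothesis `hdom`. [cite: Balaban1985Variational, (190) p.308] -/
theorem norm_apply_apply_le_loc {y : g.Site} {x : X} (hx : x ∈ box y) (f : X → ι → E') (i : ι) :
    ‖f x i‖ ≤ (supSize g box blk : BlockNorm g (X → ι → E')).loc y f :=
  (norm_le_pi_norm (f x) i).trans (norm_apply_le_loc hx f)

end Components

end Literature.MathematicalPhysics.QuantumFieldTheory.Balaban1983to89.B11SupSize190
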